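import Summits.BirchSwinnertonDyer.Rank1Residual.GaloisImage.KolyvaginCongruenceDescent
import HarnessLib

/-!
# The transfer at cocycle level along a power transversal, and the coboundary witnesses of the
# Euler-system norm relations — file G1 of THEOREM C of row T-DER (cell `b2b-bsdres`, team n1011,
# seat p11 GEN 9, OWNERS row T-DER = skel/T-DER.md STATUS v8, referee-1 GEN 35 ACK-1)

HONEST FRAMING (cell `b2b-bsdres`, run/shared/lean/b2b/bsd-rank1-residual/, verbatim in every
file): the goal of the cell is to DELETE the COMBINATION-SHAPED residual classes of the
Birch–Swinnerton-Dyer formula for ALL analytic-rank `≤ 1` elliptic curves over `ℚ` — "full BSD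
formula for every rank `≤ 1` curve in class `C`" assembled STRICTLY from published theorems — so
that the rank-`≤ 1` remainder becomes exactly the CONSTRUCTION-SHAPED classes, which are TYPED
(missing-input `Prop`s), NOT attempted. This is not "finishing BSD". Team n1011: research route on
the CONSTRUCTION-SHAPED class X4 / §I N11 (route-1 PORT, (P-DER)); TOOL theorems of continuous
group cohomology (no definition, no named fact, no `sorry`); curve-free, `p`-free.

## What

THEOREM C ([Rubin00] Thm. 4.5.4; proof after Nekovář / Perrin-Riou, Ann. Inst. Fourier 48 (1998)
§3.1, Prop. 2.2.5 (ii)) evaluates COCYCLES: every norm relation of the Euler system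
(`IsEulerSystem.cores_p`, `IsEulerSystem.cores_cons`) has to be turned into a pointwise identity of
crossed homomorphisms with an explicit coboundary witness ("grâce à la définition explicite de la
corestriction d'un cocycle", [PerrinRiou98] p. 1251).  This file supplies, for a topological
representation `X` of `G` and subgroups `H ≤ H'` with `H ⊴ G` open of finite index in `H'`:
* `resLe_coresLe_eq_sum_range` — **`res_H ∘ Cor_{H'/H} = Σ_{j<N} (σ^j ·)`** on `H¹(H, X)` when the
  powers `σ^j` (`j < N`) of an element `σ ∈ H'` form a transversal of `H' ⧸ H` (`hcov`: every coset
  is hit, `hinj`: at most once) — the power-transversal form of F2 `resLe_coresLe_eq_sum`, as used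
  for the cyclic layers `Gal(F(rq)/F(r)) = ⟨σ_q⟩` and `Gal(F_{n+k}(r)/F_n(r)) = ⟨Frob⟩`;
* `oneCocycleClass_sumConj`, `sumConj_apply` — the cocycle `Σ_i a_i • (g_i · x)` (`g · x` the
  conjugate cocycle `u ↦ g x(g⁻¹ u g)`), its class `Σ_i a_i • (g_i · [x])` and its values;
* `exists_forall_apply_eq_add_of_oneCocycleClass_eq` — equal classes differ by an EXPLICIT
  coboundary: `[φ] = [ψ] ⇒ ∃ e, ∀ u, φ(u) = ψ(u) + (u e − e)`;
* `exists_forall_sum_rho_pow_apply_eq_of_coresLe_eq` — **the norm relation `Cor_{H'/H} [x₁] = [x₀]`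
  at cocycle level**: `∃ e, ∀ u ∈ H, Σ_{j<N} σ^j x₁(σ^{-j} u σ^j) = x₀(u) + (u e − e)` — the
  hypothesis `hcor` of C0b `eq_add_rho_sub_of_sum_conj_eq` / C0c
  `exists_sub_eq_sub_one_apply_of_descent` (there evaluated at one element);
* `exists_forall_sum_rho_pow_apply_eq_of_coresLe_eq_aeval` — **the tame relation
  `Cor_{H'/H} [x₁] = P(F) [x₀]` at cocycle level** (`F` acting through `conjMap`, e.g. `F = Fr_q⁻¹`,
  `P = P(Fr_q⁻¹ | T*; X)`): `∃ b, ∀ u ∈ H, Σ_{j<N} σ^j x₁(σ^{-j} u σ^j) =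
  Σ_{k ≤ deg P} p_k • F^k x₀(F^{-k} u F^k) + (u b − b)` — the input `htrans` of THEOREM C's assembly
  (file G2) and `htame` of C0b after evaluation.
No number theory; the Euler-system instances are one `rw` away (F3a
`sum_conjMap_pow_resLe_eq_eulerFactorOp`, `EulerSystemLevels.coresP`/`coresCons` are `coresLe`).

References: B. Perrin-Riou, Ann. Inst. Fourier 48 (1998), (2.2.3)–(2.2.8), §3.1.2 (3.1.1);
K. Rubin, *Euler Systems* (2000), §4.4–§4.8; J. Neukirch, A. Schmidt, K. Wingberg, *Cohomology of
Number Fields* (2008), I §5 (1.5.6)–(1.5.7).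
-/

noncomputable section

open CategoryTheory Function Finset Polynomial
open Literature.NumberTheory.GaloisRepresentations
open Literature.NumberTheory.EllipticCurves (subgroupInclusion subgroupInclusion_apply_coe
  subgroupConj subgroupConj_apply_coe)

universe u v

namespace Summit.BirchSwinnertonDyer.Rank1Residual.GaloisImage

namespace Congruence

variable {R : Type u} [CommRing R] [TopologicalSpace R]
variable {G : Type v} [Group G] [TopologicalSpace G] [IsTopologicalGroup G]
variable (X : TopRep.{v} R G)

/-! ### §1 `res ∘ Cor = Σ_{j<N} (σ^j ·)` along a power transversal -/

/-- **`res_H ∘ Cor_{H'/H} = Σ_{j<N} (σ^j ·)` on `H¹(H, X)`** for `H ≤ H'`, `H ⊴ G` open of finite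
index in `H'`, and `σ ∈ H'` whose powers `σ^j` (`j < N`) hit every coset of `H` in `H'` (`hcov`)
exactly once (`hinj`) — F2 `resLe_coresLe_eq_sum` for the transversal `j ↦ σ^j` of the cyclic
layer `H' ⧸ H = ⟨σ⟩`.  Ref: Neukirch–Schmidt–Wingberg (2008), I §5 (1.5.6)–(1.5.7); Rubin, *Euler
Systems* (2000), proof of Lemma 4.4.2. [folklore] -/
theorem resLe_coresLe_eq_sum_range {H H' : Subgroup G} [H.Normal] (h : H ≤ H')
    (hH : IsOpen (H : Set G)) [Fintype (H' ⧸ H.subgroupOf H')] {σ : G} (hσ : σ ∈ H') {N : ℕ}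
    (hcov : ∀ g ∈ H', ∃ j < N, (σ ^ j)⁻¹ * g ∈ H)
    (hinj : ∀ j₁ < N, ∀ j₂ < N, (σ ^ j₁)⁻¹ * σ ^ j₂ ∈ H → j₁ = j₂)
    (y : continuousCohomology 1 (subgroupRep X H)) :
    resLe X h 1 (coresLe X h hH y) = ∑ j ∈ range N, conjMap X H (σ ^ j) 1 y := by
  classical
  -- the transversal `j ↦ σ^j` of `H' ⧸ H`
  let e : Fin N → H' ⧸ H.subgroupOf H' := fun j => QuotientGroup.mk ⟨σ ^ (j : ℕ), H'.pow_mem hσ j⟩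
  have he_inj : Function.Injective e := by
    intro j₁ j₂ hj
    have h12 : (⟨σ ^ (j₁ : ℕ), H'.pow_mem hσ j₁⟩ : H')⁻¹ * ⟨σ ^ (j₂ : ℕ), H'.pow_mem hσ j₂⟩ ∈
        H.subgroupOf H' := QuotientGroup.eq.mp hj
    rw [Subgroup.mem_subgroupOf] at h12
    exact Fin.ext (hinj j₁ j₁.2 j₂ j₂.2 h12)
  have he_surj : Function.Surjective e := by
    intro x
    obtain ⟨g, rfl⟩ := QuotientGroup.mk_surjective x
    obtain ⟨j, hj, hjg⟩ := hcov g g.2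
    refine ⟨⟨j, hj⟩, QuotientGroup.eq.mpr ?_⟩
    rw [Subgroup.mem_subgroupOf]
    exact hjg
  let eE : Fin N ≃ H' ⧸ H.subgroupOf H' := Equiv.ofBijective e ⟨he_inj, he_surj⟩
  let s : H' ⧸ H.subgroupOf H' → H' := fun x => ⟨σ ^ ((eE.symm x : Fin N) : ℕ), H'.pow_mem hσ _⟩
  have hs : ∀ x, (s x : H' ⧸ H.subgroupOf H') = x := fun x => by
    change e (eE.symm x) = x
    exact eE.apply_symm_apply x
  rw [Derivative.resLe_coresLe_eq_sum X h hH hs,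
    ← Fin.sum_univ_eq_sum_range (fun j => conjMap X H (σ ^ j) 1 y), ← eE.sum_comp]
  refine Finset.sum_congr rfl fun x _ => ?_
  have hx : ((s (eE x) : H') : G) = σ ^ (x : ℕ) := by
    change σ ^ ((eE.symm (eE x) : Fin N) : ℕ) = σ ^ (x : ℕ)
    rw [Equiv.symm_apply_apply]
  rw [hx]

/-! ### §2 Linear combinations of conjugate cocycles -/

omit [IsTopologicalGroup G] in
/-- Values of a scalar multiple of a cocycle. [folklore] -/
theorem smul_cocycle_apply {H : Subgroup G} (a : R) (x : contOneCocycles (subgroupRep X H))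
    (u : H) : (a • x).1 u = a • x.1 u :=
  rfl

/-- **The class of `Σ_i a_i • (g_i · x)` is `Σ_i a_i • (g_i · [x])`** (`conjMap` on explicit
cocycles, additivity and linearity of the class map). [folklore] -/
theorem oneCocycleClass_sumConj {H : Subgroup G} [H.Normal] {ι : Type*} (s : Finset ι)
    (a : ι → R) (g : ι → G) (x : contOneCocycles (subgroupRep X H)) :
    oneCocycleClass _ (∑ i ∈ s, a i •
        contOneCocycles.pullback (subgroupConj H (g i)) (conjRepHom X H (g i)) x) =
      ∑ i ∈ s, a i • conjMap X H (g i) 1 (oneCocycleClass _ x) := by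
  rw [← oneCocycleClassₗ_apply, map_sum]
  refine Finset.sum_congr rfl fun i _ => ?_
  rw [map_smul, oneCocycleClassₗ_apply, conjMap_oneCocycleClass]

/-- **Values of `Σ_i a_i • (g_i · x)`**: `u ↦ Σ_i a_i • g_i x(g_i⁻¹ u g_i)`. [folklore] -/
theorem sumConj_apply {H : Subgroup G} [H.Normal] {ι : Type*}
    (s : Finset ι) (a : ι → R) (g : ι → G) (x : contOneCocycles (subgroupRep X H)) (u : H) :
    (∑ i ∈ s, a i •
        contOneCocycles.pullback (subgroupConj H (g i)) (conjRepHom X H (g i)) x).1 u =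
      ∑ i ∈ s, a i • X.ρ (g i) (x.1 (subgroupConj H (g i) u)) := by
  rw [sum_apply_val']
  refine Finset.sum_congr rfl fun i _ => ?_
  rw [smul_cocycle_apply, conj_pullback_apply]

/-- The special case `a_i = 1`, powers of one element: the class of `Σ_{j<N} (σ^j · x)`.
[folklore] -/
theorem oneCocycleClass_sumConj_pow {H : Subgroup G} [H.Normal] (σ : G) (N : ℕ)
    (x : contOneCocycles (subgroupRep X H)) :
    oneCocycleClass _ (∑ j ∈ range N,
        contOneCocycles.pullback (subgroupConj H (σ ^ j)) (conjRepHom X H (σ ^ j)) x) =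
      ∑ j ∈ range N, conjMap X H (σ ^ j) 1 (oneCocycleClass _ x) := by
  have h := oneCocycleClass_sumConj X (range N) (fun _ => (1 : R)) (fun j => σ ^ j) x
  simp only [one_smul] at h
  exact h

/-- Values of `Σ_{j<N} (σ^j · x)`: `u ↦ Σ_{j<N} σ^j x(σ^{-j} u σ^j)`. [folklore] -/
theorem sumConj_pow_apply {H : Subgroup G} [H.Normal] (σ : G) (N : ℕ)
    (x : contOneCocycles (subgroupRep X H)) (u : H) :
    (∑ j ∈ range N,
        contOneCocycles.pullback (subgroupConj H (σ ^ j)) (conjRepHom X H (σ ^ j)) x).1 u =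
      ∑ j ∈ range N, X.ρ (σ ^ j) (x.1 (subgroupConj H (σ ^ j) u)) := by
  have h := sumConj_apply X (range N) (fun _ => (1 : R)) (fun j => σ ^ j) x u
  simp only [one_smul] at h
  exact h

/-- **The operator `P(F)` on `H¹(H, X)` on explicit cocycles**: for `F ∈ G` acting by `conjMap`
and `P = Σ_k p_k X^k ∈ R[X]`, `P(F·)[x] = [Σ_{k ≤ deg P} p_k • (F^k · x)]`
(`Polynomial.aeval_eq_sum_range`, F2 `conjMap_hom_pow_apply`). [folklore] -/
theorem aeval_conjMap_oneCocycleClass {H : Subgroup G} [H.Normal] (F : G) (P : R[X])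
    (x : contOneCocycles (subgroupRep X H)) :
    aeval (conjMap X H F 1).hom.toLinearMap P (oneCocycleClass _ x) =
      oneCocycleClass _ (∑ k ∈ range (P.natDegree + 1), P.coeff k •
        contOneCocycles.pullback (subgroupConj H (F ^ k)) (conjRepHom X H (F ^ k)) x) := by
  rw [oneCocycleClass_sumConj, aeval_eq_sum_range, LinearMap.sum_apply]
  refine Finset.sum_congr rfl fun k _ => ?_
  rw [LinearMap.smul_apply, Derivative.conjMap_hom_pow_apply]

/-! ### §3 From class identities to pointwise identities with a coboundary witness -/

/-- **Equal classes differ by an explicit coboundary**: `[φ] = [ψ]` in `H¹(H, X)` iff-direction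
`⇒`: `∃ e ∈ X, ∀ u ∈ H, φ(u) = ψ(u) + (u e − e)`. [folklore] -/
theorem exists_forall_apply_eq_add_of_oneCocycleClass_eq {H : Subgroup G}
    (φ ψ : contOneCocycles (subgroupRep X H)) (h : oneCocycleClass _ φ = oneCocycleClass _ ψ) :
    ∃ e : X, ∀ u : H, φ.1 u = ψ.1 u + (X.ρ (u : G) e - e) := by
  rw [← sub_eq_zero, ← oneCocycleClass_sub, oneCocycleClass_eq_zero_iff] at h
  obtain ⟨e, he⟩ := h
  refine ⟨e, fun u => ?_⟩
  have hu := he u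
  rw [Submodule.coe_sub, ContinuousMap.sub_apply, sub_eq_iff_eq_add'] at hu
  rw [hu]
  rfl

omit [IsTopologicalGroup G] in
/-- Values of the restriction `res_{H ≤ H'} x₀` of an explicit cocycle: `x₀` at the included
element. [folklore] -/
theorem resLe_pullback_apply {H H' : Subgroup G} (h : H ≤ H')
    (x₀ : contOneCocycles (subgroupRep X H')) (u : H) :
    (contOneCocycles.pullback (subgroupInclusion h)
        (Y := subgroupRep X H) (TopRep.ofHom ⟨ContinuousLinearMap.id R X, fun _ => rfl⟩) x₀).1 u =
      x₀.1 (subgroupInclusion h u) :=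
  rfl

/-- **The norm relation `Cor_{H'/H} [x₁] = [x₀]` at cocycle level** ([PerrinRiou98] (2.2.3),
(2.2.6): "grâce à la définition explicite de la corestriction d'un cocycle").  For `H ≤ H'`,
`H ⊴ G` open of finite index in `H'`, a power transversal `σ^j` (`j < N`) of `H' ⧸ H`, and
cocycles `x₁` on `H`, `x₀` on `H'` with `Cor [x₁] = [x₀]`:
`∃ e ∈ X, ∀ u ∈ H, Σ_{j<N} σ^j x₁(σ^{-j} u σ^j) = x₀(u) + (u e − e)`.
(Restrict the class identity to `H` by `resLe_coresLe_eq_sum_range` and read it on cocycles.)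
This is hypothesis `hcor` of C0b `eq_add_rho_sub_of_sum_conj_eq` and of C0c
`exists_sub_eq_sub_one_apply_of_descent` for the `K_∞`-direction relation
`IsEulerSystem.cores_p`. [cite: PerrinRiou1998AIF, Prop. 2.2.5 (ii) proof, (2.2.6)] -/
theorem exists_forall_sum_rho_pow_apply_eq_of_coresLe_eq {H H' : Subgroup G} [H.Normal]
    (h : H ≤ H') (hH : IsOpen (H : Set G)) [Fintype (H' ⧸ H.subgroupOf H')] {σ : G} (hσ : σ ∈ H')
    {N : ℕ} (hcov : ∀ g ∈ H', ∃ j < N, (σ ^ j)⁻¹ * g ∈ H)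
    (hinj : ∀ j₁ < N, ∀ j₂ < N, (σ ^ j₁)⁻¹ * σ ^ j₂ ∈ H → j₁ = j₂)
    (x₁ : contOneCocycles (subgroupRep X H)) (x₀ : contOneCocycles (subgroupRep X H'))
    (hCor : coresLe X h hH (oneCocycleClass _ x₁) = oneCocycleClass _ x₀) :
    ∃ e : X, ∀ u : H, ∑ j ∈ range N, X.ρ (σ ^ j) (x₁.1 (subgroupConj H (σ ^ j) u)) =
      x₀.1 (subgroupInclusion h u) + (X.ρ (u : G) e - e) := by
  have hres := congrArg (resLe X h 1) hCor
  rw [resLe_coresLe_eq_sum_range X h hH hσ hcov hinj, ← oneCocycleClass_sumConj_pow,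
    resLe_oneCocycleClass] at hres
  obtain ⟨e, he⟩ := exists_forall_apply_eq_add_of_oneCocycleClass_eq X _ _ hres
  refine ⟨e, fun u => ?_⟩
  rw [← sumConj_pow_apply, he u, resLe_pullback_apply]

/-- **`res` commutes with `P(F·)`** on `H¹`: for `H ≤ H'` both normal in `G`, `F ∈ G`, `P ∈ R[X]`,
`res_H (P(F·) y) = P(F·) (res_H y)` (F2 `resLe_conjMap` through F1 `apply_aeval_apply_eq_of_comm`;
F3a `resLe_eulerFactorOp` is the Euler-factor instance). [folklore] -/
theorem resLe_aeval_conjMap {H H' : Subgroup G} [H.Normal] [H'.Normal] (h : H ≤ H') (F : G)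
    (P : R[X]) (y : continuousCohomology 1 (subgroupRep X H')) :
    resLe X h 1 (aeval (conjMap X H' F 1).hom.toLinearMap P y) =
      aeval (conjMap X H F 1).hom.toLinearMap P (resLe X h 1 y) :=
  Derivative.apply_aeval_apply_eq_of_comm (resLe X h 1).hom.toLinearMap
    (F := (conjMap X H' F 1).hom.toLinearMap) (F' := (conjMap X H F 1).hom.toLinearMap)
    (fun v => Derivative.resLe_conjMap X h F v) P y

/-- **The tame relation `Cor_{H'/H} [x₁] = P(F) [x₀]` at cocycle level** ([PerrinRiou98] (2.2.4),
(2.2.8); Rubin §4.8).  For `H ≤ H'` both normal in `G`, `H` open of finite index in `H'`, a power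
transversal `σ^j` (`j < N`) of `H' ⧸ H`, an element `F ∈ G` acting on `H¹(H', X)` by `conjMap`
(for an Euler system `F = Fr_q⁻¹`, so that `P(F·) = eulerFactorOp`), a polynomial
`P = Σ_k p_k X^k ∈ R[X]`, and cocycles `x₁` on `H`, `x₀` on `H'` with `Cor [x₁] = P(F·)[x₀]`:
`∃ b ∈ X, ∀ u ∈ H, Σ_{j<N} σ^j x₁(σ^{-j} u σ^j) = Σ_{k ≤ deg P} p_k • F^k x₀(F^{-k} u F^k) + (u b − b)`.
This is the `T`-level transfer identity `htrans` consumed by THEOREM C's assembly (file G2) and,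
evaluated at a Frobenius power, `htame` of C0b `exists_sub_eq_sub_one_apply_of_ascent`.
[cite: PerrinRiou1998AIF, Prop. 2.2.5 (ii) proof, (2.2.4) and (2.2.8)] -/
theorem exists_forall_sum_rho_pow_apply_eq_of_coresLe_eq_aeval {H H' : Subgroup G} [H.Normal]
    [H'.Normal] (h : H ≤ H') (hH : IsOpen (H : Set G)) [Fintype (H' ⧸ H.subgroupOf H')] {σ : G}
    (hσ : σ ∈ H') {N : ℕ} (hcov : ∀ g ∈ H', ∃ j < N, (σ ^ j)⁻¹ * g ∈ H)
    (hinj : ∀ j₁ < N, ∀ j₂ < N, (σ ^ j₁)⁻¹ * σ ^ j₂ ∈ H → j₁ = j₂)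
    (F : G) (P : R[X])
    (x₁ : contOneCocycles (subgroupRep X H)) (x₀ : contOneCocycles (subgroupRep X H'))
    (hCor : coresLe X h hH (oneCocycleClass _ x₁) =
      aeval (conjMap X H' F 1).hom.toLinearMap P (oneCocycleClass _ x₀)) :
    ∃ b : X, ∀ u : H, ∑ j ∈ range N, X.ρ (σ ^ j) (x₁.1 (subgroupConj H (σ ^ j) u)) =
      ∑ k ∈ range (P.natDegree + 1),
          P.coeff k • X.ρ (F ^ k) (x₀.1 (subgroupConj H' (F ^ k) (subgroupInclusion h u))) +
        (X.ρ (u : G) b - b) := by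
  have hres := congrArg (resLe X h 1) hCor
  rw [resLe_coresLe_eq_sum_range X h hH hσ hcov hinj, ← oneCocycleClass_sumConj_pow,
    resLe_aeval_conjMap, resLe_oneCocycleClass, aeval_conjMap_oneCocycleClass] at hres
  obtain ⟨b, hb⟩ := exists_forall_apply_eq_add_of_oneCocycleClass_eq X _ _ hres
  refine ⟨b, fun u => ?_⟩
  rw [← sumConj_pow_apply, hb u, sumConj_apply]
  rfl

end Congruence

end Summit.BirchSwinnertonDyer.Rank1Residual.GaloisImage

end
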